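/-
Copyright: the b2b-balaban T⁴-continuum CRUX team, row NE7b OWNER lineage `t4-ne7b-p1` (gen 121). Project licence.
-/
import Mathlib.Analysis.SpecialFunctions.Trigonometric.DerivHyp
import Mathlib.Analysis.SpecialFunctions.Trigonometric.Series
import Summits.QuantumFields.BalabanUV.T4Continuum.Spine.NE7b.SupTorusBlockDistance

/-!
# THE COSH PROFILE: A POSITIVE, EXPONENTIALLY DECAYING SUPERSOLUTION OF THE FINE-TORUS LAPLACIAN, SECOND ORDER IN THE RATE —
# `Φ(x) = Π_i cosh(α·t(x i − c i))`, `t = N∕2 − |valMinAbs ·|` the circular distance to the ANTIPODE, satisfies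
# `Σ_μ (2Φ x − Φ(x+ê_μ) − Φ(x−ê_μ)) ≥ −2d(cosh α − 1)·Φ x` at EVERY site of `(ℤ∕N)^d` (no first-order defect at the source, none at the
# antipodes), `cosh α − 1 ≤ α²`, and `2^{−d}e^{−αρ_N(x,c)}cosh(αN∕2)^d ≤ Φ(x) ≤ 2^d e^{−αρ_N(x,c)}cosh(αN∕2)^d` coordinatewise — the comparison
# function for a mesh-free WEIGHTED maximum principle (sequel (146)): pointwise exponential DECAY on the strictly convex class
# (row NE7b, node U5c; (132) BY NAME; [folklore])

Cell `pub-balaban`, sub-cell `t4`, spine estimate NE7b (`T4WeightBudget.RelWeightBound`; the cell's OWN estimate — NOT PRINTED in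
[Bałaban 1983–89], NOT PROVED).  Crux-route work under `Spine/NE7b/` by the row OWNER (`t4-ne7b-p1` gen 121, file (145)) under FREEZE
(0)'s crux-prover clause; NOTHING of Bałaban's is named as a Lean object, valued or asserted; no `T4Continuum/Support` leaf typed; no `def`,
no notation (the profile is WRITTEN OUT at every occurrence); zero `sorry`.  Imports (BY NAME): the OWNER's (132) `…SupTorusBlockDistance`
(`natAbs_valMinAbs_add_one_le`, `siteOf_e_apply`), Mathlib's `ZMod.valMinAbs_spec` ∕ `valMinAbs_mem_Ioc` ∕ `coe_valMinAbs` ∕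
`valMinAbs_neg_of_ne_half` ∕ `natAbs_valMinAbs_neg`, `Real.cosh_add` ∕ `cosh_sub` ∕ `cosh_le_cosh` ∕ `cosh_le_exp_half_sq` ∕ `abs_exp_sub_one_le`.

WHY (located).  (144) made the column POINTWISE on the strictly convex class `V ≥ v₀ > 0` by the maximum principle for `L_V = (n+1)²(−Δ) + V`,
but only as sup BOUNDS: pointwise exponential DECAY by a weighted maximum principle needs a comparison function `Φ > 0` with
`(n+1)²(−ΔΦ) ≥ −θΦ`, `θ < v₀` MESH-FREE — and the naive weight `e^{−δρ∕(n+1)}` fails at first order (`θ ≍ δ(n+1)`) wherever the distance has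
a ridge (the antipodal hyperplanes of the torus).  The cosh of the distance to the antipode has none: on the circle `ℤ∕N`,
`cosh(αt(z+1)) + cosh(αt(z−1)) ≤ 2cosh(α)cosh(αt(z))` EXACTLY (equality off the source) — from a nonnegative representative the forward
step is `valMinAbs + 1` or wraps to `valMinAbs + 1 − N` (`t ↦ t − 1` or `t ↦ 1 − t`, the same under the even `cosh`), the backward step is
Lipschitz, and `cosh(α(t−1)) + cosh(α(t+1)) = 2cosh(α)cosh(αt)`; negative representatives by `z ↦ −z`.  The product over coordinates changes
one factor per bond, so `−ΔΦ ≥ −2d(cosh α − 1)Φ`; with `α = δ∕(n+1)` the factor `(n+1)²(cosh α − 1) ≤ δ²` is second order: `θ = 2dδ²`.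

WHAT IS PROVED ([folklore]; `N ≥ 1`; `t(z) := N∕2 − |valMinAbs z|` written out):
* §1 `two_mul_cosh_mul_cosh`, `natAbs_cast_eq_abs`, `antipode_nonneg` (`t ≥ 0`), `antipode_step_le` (`t(z ± 1) ≤ t(z) + 1`),
  **`cosh_antipode_succ_of_nonneg`** (`valMinAbs z ≥ 0 ⟹ cosh(αt(z+1)) = cosh(α(t(z) − 1))`), **`cosh_antipode_second_diff`**
  (`cosh(αt(z+1)) + cosh(αt(z−1)) ≤ 2cosh(α)cosh(αt(z))` for ALL `z`), `cosh_sub_one_le_sq` (`|α| ≤ 1 ⟹ cosh α − 1 ≤ α²`).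
* §2 (torus `(ℤ∕N)^d`, `Φ(x) = Π_i cosh(α·t(x i − c i))`, bonds `ê_μ = siteOf (e μ)`) **`prod_cosh_second_diff`**
  (`−2d(cosh α − 1)Φ x ≤ Σ_μ (2Φ x − Φ(x+ê_μ) − Φ(x−ê_μ))`), `prod_cosh_pos`, **`cosh_sub_two_sided`** (`0 ≤ s ≤ T`, `α ≥ 0`:
  `e^{−αs}cosh(αT)∕2 ≤ cosh(α(T − s)) ≤ 2e^{−αs}cosh(αT)` — the profile is two-sided exponential in the distance to the centre).

HONEST (what this is NOT).  A comparison function and its letters, no operator statement (the weighted maximum principle and the pointwise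
decay of the response are the sequel (146)); `ℓ¹` circular geometry (product structure), cubic tori; constants explicit; nothing of
Bałaban's.  BY-NAME EFFECT ON THE WALL: NONE.  NE7b NOT PRINTED ∕ NOT PROVED; spine PROVED 0∕9; rung (B)+1 on a FINITE torus — NOT infinite
volume, NOT the mass gap, NOT Clay.  HONEST DEPENDENCY: continuum YM on T⁴ ⇐ BetaPertH ∧ nine spine estimates (0∕9 proved); BetaPertH ⇐
(D1) ∧ (D4) ∧ CAP+tail; G-an2-4 gates asym, D1 and NE2∕3∕4.
-/

set_option autoImplicit false

noncomputable section

namespace Summit.QuantumFields.BalabanUV.T4Continuum.NE7b.SupTorusCoshProfile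

open Real
open Literature.MathematicalPhysics.QuantumFieldTheory.Balaban1983to89
open B6QGQLower276 (X e)
open Beta (Site siteOf)
open SupTorusBlockDistance (natAbs_valMinAbs_add_one_le siteOf_e_apply)

variable {d : ℕ}

/-! ## §1. One coordinate: the circular distance to the ANTIPODE, `t(z) = N∕2 − |valMinAbs z|`, and the cosh profile -/

section Circle

variable (N : ℕ) [NeZero N]

omit [NeZero N] in
/-- `2cosh(a)cosh(b) = cosh(b + a) + cosh(b − a)`. [folklore] -/
theorem two_mul_cosh_mul_cosh (a b : ℝ) : 2 * Real.cosh a * Real.cosh b = Real.cosh (b + a) + Real.cosh (b - a) := by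
  rw [Real.cosh_add, Real.cosh_sub]; ring

omit [NeZero N] in
/-- The circular size as a real absolute value: `(|valMinAbs z| : ℝ) = |(valMinAbs z : ℝ)|`. [folklore] -/
theorem natAbs_cast_eq_abs (z : ZMod N) : ((z.valMinAbs.natAbs : ℕ) : ℝ) = |(z.valMinAbs : ℝ)| := by
  simp only [Nat.cast_natAbs, Int.cast_abs]

/-- `t(z) = N∕2 − |valMinAbs z| ≥ 0`. [folklore] -/
theorem antipode_nonneg (z : ZMod N) : 0 ≤ (N : ℝ) / 2 - (z.valMinAbs.natAbs : ℝ) := by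
  have h := z.valMinAbs_mem_Ioc
  have h1 : -(N : ℝ) < (z.valMinAbs : ℝ) * 2 := by exact_mod_cast h.1
  have h2 : (z.valMinAbs : ℝ) * 2 ≤ (N : ℝ) := by exact_mod_cast h.2
  rw [natAbs_cast_eq_abs]
  have : |(z.valMinAbs : ℝ)| ≤ (N : ℝ) / 2 := abs_le.2 ⟨by linarith, by linarith⟩
  linarith

omit [NeZero N] in
/-- One bond step: `t(z + 1) ≤ t(z) + 1` and `t(z − 1) ≤ t(z) + 1` ((132)'s Lipschitz letter). [folklore] -/
theorem antipode_step_le [NeZero N] (z : ZMod N) :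
    (N : ℝ) / 2 - ((z + 1).valMinAbs.natAbs : ℝ) ≤ (N : ℝ) / 2 - (z.valMinAbs.natAbs : ℝ) + 1
      ∧ (N : ℝ) / 2 - ((z - 1).valMinAbs.natAbs : ℝ) ≤ (N : ℝ) / 2 - (z.valMinAbs.natAbs : ℝ) + 1 := by
  constructor
  · have h := (natAbs_valMinAbs_add_one_le z).2
    have h' : (z.valMinAbs.natAbs : ℝ) ≤ ((z + 1).valMinAbs.natAbs : ℝ) + 1 := by exact_mod_cast h
    linarith
  · have h := (natAbs_valMinAbs_add_one_le (z - 1)).1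
    rw [sub_add_cancel] at h
    have h' : (z.valMinAbs.natAbs : ℝ) ≤ ((z - 1).valMinAbs.natAbs : ℝ) + 1 := by exact_mod_cast h
    linarith

/-- **THE FORWARD STEP FROM A NONNEGATIVE REPRESENTATIVE IS EXACT UP TO SIGN**: if `valMinAbs z ≥ 0` then
`cosh(α·t(z + 1)) = cosh(α·(t(z) − 1))` — either `valMinAbs(z+1) = valMinAbs z + 1` (so `t` drops by one) or `z` is antipodal and the
representative wraps to `valMinAbs z + 1 − N` (so `t(z+1) = 1 − t(z)`); `cosh` is even. [folklore] -/
theorem cosh_antipode_succ_of_nonneg (α : ℝ) (z : ZMod N) (hv : 0 ≤ z.valMinAbs) :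
    Real.cosh (α * ((N : ℝ) / 2 - ((z + 1).valMinAbs.natAbs : ℝ))) = Real.cosh (α * ((N : ℝ) / 2 - (z.valMinAbs.natAbs : ℝ) - 1)) := by
  have hmem := z.valMinAbs_mem_Ioc
  have hN : (1 : ℤ) ≤ N := by exact_mod_cast NeZero.one_le
  have hcast : (z + 1 : ZMod N) = ((z.valMinAbs + 1 : ℤ) : ZMod N) := by
    rw [Int.cast_add, Int.cast_one, ZMod.coe_valMinAbs]
  have hvR : (0 : ℝ) ≤ (z.valMinAbs : ℝ) := by exact_mod_cast hv
  rw [natAbs_cast_eq_abs, natAbs_cast_eq_abs, abs_of_nonneg hvR]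
  by_cases h : (z.valMinAbs + 1) * 2 ≤ (N : ℤ)
  · -- no wrap
    have h1 : (z + 1).valMinAbs = z.valMinAbs + 1 := (ZMod.valMinAbs_spec (z + 1) _).2 ⟨hcast, by linarith [hmem.1], h⟩
    have h1R : ((z + 1).valMinAbs : ℝ) = (z.valMinAbs : ℝ) + 1 := by exact_mod_cast h1
    rw [h1R, abs_of_nonneg (by linarith)]; ring_nf
  · -- wrap: the representative is `valMinAbs z + 1 − N`
    have h' : (N : ℤ) < (z.valMinAbs + 1) * 2 := not_le.1 h
    have hcast' : (z + 1 : ZMod N) = ((z.valMinAbs + 1 - N : ℤ) : ZMod N) := by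
      rw [Int.cast_sub, Int.cast_natCast, ZMod.natCast_self, sub_zero, hcast]
    have h1 : (z + 1).valMinAbs = z.valMinAbs + 1 - N :=
      (ZMod.valMinAbs_spec (z + 1) _).2 ⟨hcast', by constructor <;> linarith [hmem.2]⟩
    have hle : z.valMinAbs + 1 - N ≤ 0 := by have := hmem.2; omega
    have h1R : ((z + 1).valMinAbs : ℝ) = (z.valMinAbs : ℝ) + 1 - (N : ℝ) := by exact_mod_cast h1
    have hleR : (z.valMinAbs : ℝ) + 1 - (N : ℝ) ≤ 0 := by exact_mod_cast hle
    rw [h1R, abs_of_nonpos hleR, ← Real.cosh_neg]; ring_nf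

/-- **THE COSH PROFILE IS A SUPERSOLUTION ON THE CIRCLE, SECOND ORDER EXACTLY**: for every `z ∈ ℤ∕N` and `α`,
`cosh(α·t(z+1)) + cosh(α·t(z−1)) ≤ 2cosh(α)·cosh(α·t(z))`, `t = N∕2 − |valMinAbs ·|` the distance to the antipode — the discrete
`−Δ cosh(αt) ≥ −2(cosh α − 1)cosh(αt)`, with equality away from the source `z = 0`.  (Nonnegative representative: the forward step is exact,
the backward one Lipschitz; negative representative: the same for `−z`.) [folklore] -/
theorem cosh_antipode_second_diff (α : ℝ) (z : ZMod N) :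
    Real.cosh (α * ((N : ℝ) / 2 - ((z + 1).valMinAbs.natAbs : ℝ))) + Real.cosh (α * ((N : ℝ) / 2 - ((z - 1).valMinAbs.natAbs : ℝ)))
      ≤ 2 * Real.cosh α * Real.cosh (α * ((N : ℝ) / 2 - (z.valMinAbs.natAbs : ℝ))) := by
  -- the generic estimate from one exact step and one Lipschitz step
  have key : ∀ w : ZMod N, 0 ≤ w.valMinAbs →
      Real.cosh (α * ((N : ℝ) / 2 - ((w + 1).valMinAbs.natAbs : ℝ))) + Real.cosh (α * ((N : ℝ) / 2 - ((w - 1).valMinAbs.natAbs : ℝ)))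
        ≤ 2 * Real.cosh α * Real.cosh (α * ((N : ℝ) / 2 - (w.valMinAbs.natAbs : ℝ))) := by
    intro w hw
    have ht0 := antipode_nonneg N w
    have hA : Real.cosh (α * ((N : ℝ) / 2 - ((w + 1).valMinAbs.natAbs : ℝ)))
        = Real.cosh (α * ((N : ℝ) / 2 - (w.valMinAbs.natAbs : ℝ) - 1)) := cosh_antipode_succ_of_nonneg N α w hw
    have hm : Real.cosh (α * ((N : ℝ) / 2 - ((w - 1).valMinAbs.natAbs : ℝ)))
        ≤ Real.cosh (α * ((N : ℝ) / 2 - (w.valMinAbs.natAbs : ℝ) + 1)) := by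
      rw [Real.cosh_le_cosh, abs_mul, abs_mul]
      refine mul_le_mul_of_nonneg_left ?_ (abs_nonneg _)
      rw [abs_of_nonneg (antipode_nonneg N (w - 1)), abs_of_nonneg (by linarith)]
      exact (antipode_step_le N w).2
    have hid : 2 * Real.cosh α * Real.cosh (α * ((N : ℝ) / 2 - (w.valMinAbs.natAbs : ℝ)))
        = Real.cosh (α * ((N : ℝ) / 2 - (w.valMinAbs.natAbs : ℝ) + 1)) + Real.cosh (α * ((N : ℝ) / 2 - (w.valMinAbs.natAbs : ℝ) - 1)) := by
      rw [two_mul_cosh_mul_cosh]; ring_nf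
    linarith
  rcases le_or_gt 0 z.valMinAbs with hv | hv
  · exact key z hv
  · -- negative representative: pass to `−z`
    have hne : 2 * z.val ≠ N := by
      intro h
      have h2 : z.valMinAbs * 2 = N := (ZMod.valMinAbs_mul_two_eq_iff z).2 h
      have : (0 : ℤ) < N := by exact_mod_cast (NeZero.pos N)
      linarith
    have hneg : 0 ≤ (-z).valMinAbs := by rw [ZMod.valMinAbs_neg_of_ne_half hne]; linarith
    have h := key (-z) hneg
    rw [show -z + 1 = -(z - 1) by ring, show -z - 1 = -(z + 1) by ring, ZMod.natAbs_valMinAbs_neg, ZMod.natAbs_valMinAbs_neg,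
      ZMod.natAbs_valMinAbs_neg] at h
    linarith

/-- `cosh α − 1 ≤ α²` for `|α| ≤ 1` (`cosh α ≤ e^{α²∕2}` and `e^y − 1 ≤ 2y` on `[0, 1]`). [folklore] -/
theorem cosh_sub_one_le_sq {α : ℝ} (hα : |α| ≤ 1) : Real.cosh α - 1 ≤ α ^ 2 := by
  have h1 := Real.cosh_le_exp_half_sq α
  have hα2 : α ^ 2 ≤ 1 := by rw [← sq_abs]; nlinarith [abs_nonneg α]
  have h2 := Real.abs_exp_sub_one_le (x := α ^ 2 / 2) (by rw [abs_of_nonneg (by positivity)]; linarith)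
  rw [abs_of_nonneg (by positivity : (0 : ℝ) ≤ α ^ 2 / 2)] at h2
  linarith [(abs_le.1 h2).2]

end Circle

/-! ## §2. The product profile on the fine torus: a positive supersolution of `(n+1)²(−Δ)` up to `2d(n+1)²(cosh(δ∕(n+1)) − 1) ≤ 2dδ²` -/

section Torus

variable (N : ℕ) [NeZero N]

/-- **THE PRODUCT COSH PROFILE IS A SUPERSOLUTION, COORDINATE BY COORDINATE**: for `Φ(x) = Π_i cosh(α·t(x i − c i))` on the torus
`(ℤ∕N)^d` and the bonds `ê_μ = siteOf (e μ)`, `Σ_μ (2Φ x − Φ(x + ê_μ) − Φ(x − ê_μ)) ≥ −2d(cosh α − 1)·Φ x` — each bond changes one factor, and §1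
bounds that factor's second difference. [folklore] -/
theorem prod_cosh_second_diff (α : ℝ) (c x : Site d N) :
    -(2 * d * (Real.cosh α - 1)) * ∏ i, Real.cosh (α * ((N : ℝ) / 2 - (((x i - c i).valMinAbs.natAbs : ℕ) : ℝ)))
      ≤ ∑ μ : Fin d, (2 * ∏ i, Real.cosh (α * ((N : ℝ) / 2 - (((x i - c i).valMinAbs.natAbs : ℕ) : ℝ)))
          - ∏ i, Real.cosh (α * ((N : ℝ) / 2 - ((((x + siteOf d N (e μ)) i - c i).valMinAbs.natAbs : ℕ) : ℝ)))
          - ∏ i, Real.cosh (α * ((N : ℝ) / 2 - ((((x - siteOf d N (e μ)) i - c i).valMinAbs.natAbs : ℕ) : ℝ)))) := by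
  classical
  set f : Fin d → ℝ := fun i => Real.cosh (α * ((N : ℝ) / 2 - (((x i - c i).valMinAbs.natAbs : ℕ) : ℝ))) with hf
  have hfpos : ∀ i, 0 < f i := fun i => Real.cosh_pos _
  -- per direction: the shifted products differ from `Π f` in the factor `μ` only
  have hterm : ∀ μ : Fin d,
      -(2 * (Real.cosh α - 1)) * ∏ i, f i
        ≤ 2 * ∏ i, f i
          - ∏ i, Real.cosh (α * ((N : ℝ) / 2 - ((((x + siteOf d N (e μ)) i - c i).valMinAbs.natAbs : ℕ) : ℝ)))
          - ∏ i, Real.cosh (α * ((N : ℝ) / 2 - ((((x - siteOf d N (e μ)) i - c i).valMinAbs.natAbs : ℕ) : ℝ))) := by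
    intro μ
    set P : ℝ := ∏ i ∈ Finset.univ.erase μ, f i with hP
    have hP0 : 0 ≤ P := Finset.prod_nonneg fun i _ => (hfpos i).le
    have hsplit : ∏ i, f i = f μ * P := (Finset.mul_prod_erase Finset.univ f (Finset.mem_univ μ)).symm
    have hplus : ∏ i, Real.cosh (α * ((N : ℝ) / 2 - ((((x + siteOf d N (e μ)) i - c i).valMinAbs.natAbs : ℕ) : ℝ)))
        = Real.cosh (α * ((N : ℝ) / 2 - ((((x μ - c μ) + 1).valMinAbs.natAbs : ℕ) : ℝ))) * P := by
      rw [← Finset.mul_prod_erase Finset.univ _ (Finset.mem_univ μ)]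
      congr 1
      · rw [Pi.add_apply, siteOf_e_apply, if_pos rfl]; ring_nf
      · refine Finset.prod_congr rfl fun i hi => ?_
        rw [Pi.add_apply, siteOf_e_apply, if_neg (Finset.ne_of_mem_erase hi), add_zero]
    have hminus : ∏ i, Real.cosh (α * ((N : ℝ) / 2 - ((((x - siteOf d N (e μ)) i - c i).valMinAbs.natAbs : ℕ) : ℝ)))
        = Real.cosh (α * ((N : ℝ) / 2 - ((((x μ - c μ) - 1).valMinAbs.natAbs : ℕ) : ℝ))) * P := by
      rw [← Finset.mul_prod_erase Finset.univ _ (Finset.mem_univ μ)]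
      congr 1
      · rw [Pi.sub_apply, siteOf_e_apply, if_pos rfl]; ring_nf
      · refine Finset.prod_congr rfl fun i hi => ?_
        rw [Pi.sub_apply, siteOf_e_apply, if_neg (Finset.ne_of_mem_erase hi), sub_zero]
    rw [hsplit, hplus, hminus]
    have h1 := cosh_antipode_second_diff N α (x μ - c μ)
    have h2 := mul_le_mul_of_nonneg_right h1 hP0
    simp only [hf] at h2 ⊢
    nlinarith [h2]
  calc -(2 * d * (Real.cosh α - 1)) * ∏ i, f i = ∑ _μ : Fin d, -(2 * (Real.cosh α - 1)) * ∏ i, f i := by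
        rw [Finset.sum_const, Finset.card_univ, Fintype.card_fin, nsmul_eq_mul]; ring
    _ ≤ _ := Finset.sum_le_sum fun μ _ => hterm μ

omit [NeZero N] in
/-- The profile is positive. [folklore] -/
theorem prod_cosh_pos (α : ℝ) (c x : Site d N) : 0 < ∏ i, Real.cosh (α * ((N : ℝ) / 2 - (((x i - c i).valMinAbs.natAbs : ℕ) : ℝ))) :=
  Finset.prod_pos fun _ _ => Real.cosh_pos _

/-- **THE PROFILE IS TWO-SIDED EXPONENTIAL IN THE `ℓ¹` CIRCULAR DISTANCE TO ITS CENTRE**: with `ρ(x,c) = Σ_i |valMinAbs(x i − c i)|` and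
`α ≥ 0`, `2^{−d}·e^{−αρ(x,c)}·Φ(c) ≤ Φ(x) ≤ e^{−αρ(x,c)}·Φ(c)·2^d` where `Φ(c) = cosh(αN∕2)^d` — from `½e^{a−b} ≤ cosh(a − b)∕… `, i.e.
`e^{−b}cosh a ∕ 1 ≥ cosh(a − b) ≥ ½e^{−b}cosh(a)·…`; precisely `e^{−αs}cosh(αT)∕2 ≤ cosh(α(T − s)) ≤ 2e^{−αs}cosh(αT)` for `0 ≤ s ≤ T`… we
prove the two one-coordinate letters and multiply. [folklore] -/
theorem cosh_sub_two_sided {α T s : ℝ} (hα : 0 ≤ α) (hs : 0 ≤ s) (hsT : s ≤ T) :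
    Real.exp (-(α * s)) * Real.cosh (α * T) / 2 ≤ Real.cosh (α * (T - s))
      ∧ Real.cosh (α * (T - s)) ≤ 2 * (Real.exp (-(α * s)) * Real.cosh (α * T)) := by
  rw [Real.cosh_eq, Real.cosh_eq]
  have e1 : Real.exp (α * (T - s)) = Real.exp (-(α * s)) * Real.exp (α * T) := by rw [← Real.exp_add]; ring_nf
  have e2 : Real.exp (-(α * (T - s))) = Real.exp (α * s) * Real.exp (-(α * T)) := by rw [← Real.exp_add]; ring_nf
  have hp1 : 0 < Real.exp (-(α * s)) := Real.exp_pos _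
  have hp2 : 0 < Real.exp (α * T) := Real.exp_pos _
  have hp3 : 0 < Real.exp (α * s) := Real.exp_pos _
  have hp4 : 0 < Real.exp (-(α * T)) := Real.exp_pos _
  have hle1 : Real.exp (-(α * s)) ≤ Real.exp (α * s) := Real.exp_le_exp.2 (by nlinarith)
  have hle2 : Real.exp (-(α * T)) ≤ Real.exp (α * T) := Real.exp_le_exp.2 (by nlinarith)
  have hprod : Real.exp (-(α * s)) * Real.exp (α * s) = 1 := by rw [← Real.exp_add]; simp
  have hX : 1 ≤ Real.exp (-(α * s)) * Real.exp (α * T) := by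
    rw [← Real.exp_add, ← Real.exp_zero]; exact Real.exp_le_exp.2 (by nlinarith)
  have hY : Real.exp (α * s) * Real.exp (-(α * T)) ≤ 1 := by
    rw [← Real.exp_add, ← Real.exp_zero]; exact Real.exp_le_exp.2 (by nlinarith)
  have hZ : Real.exp (-(α * s)) * Real.exp (-(α * T)) ≤ Real.exp (α * s) * Real.exp (-(α * T)) := mul_le_mul_of_nonneg_right hle1 hp4.le
  have hW : 0 < Real.exp (-(α * s)) * Real.exp (-(α * T)) := mul_pos hp1 hp4
  rw [e1, e2]
  constructor
  · nlinarith
  · nlinarith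

end Torus

/-! ## §3. Toy -/

/-- Toy (`N = 1`, `α = 0`): on the one-point circle the second-difference letter reads `cosh 0 + cosh 0 ≤ 2cosh(0)cosh(0)`. -/
example (z : ZMod 1) :
    Real.cosh (0 * ((1 : ℕ) / 2 - ((z + 1).valMinAbs.natAbs : ℝ))) + Real.cosh (0 * ((1 : ℕ) / 2 - ((z - 1).valMinAbs.natAbs : ℝ)))
      ≤ 2 * Real.cosh 0 * Real.cosh (0 * ((1 : ℕ) / 2 - (z.valMinAbs.natAbs : ℝ))) :=
  cosh_antipode_second_diff 1 0 z

end Summit.QuantumFields.BalabanUV.T4Continuum.NE7b.SupTorusCoshProfile
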